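import Summits.KontsevichZagierPeriods.Zeta5Search.TwoTaleOmega.StepER

/-!
# (bmiss)@Ω — the recurrence in direction `e` for the sign-free forms `U1`, `U0` (cell `pub-zeta5`, cert-1 gen 4)

HONEST FRAMING: systematic search; recurrence certificates; no irrationality claim unless certified. Pure finite algebra
over `ℚ`; no named fact, no `sorry`.

Direction `δ = e = (0,0,1,0,0)`, on the template of `StepB`: `rec_e` (`Σ_{k<4} c^e_k(p)·U1/U0(p+kδ_e) = 0` for
`p, …, p+3δ_e ∈ Ω`) and `step_e` (`c^e_3 ≠ 0` on Ω). The plug-in form for cert-2's `eq_on_Omega_all` (the `δ = dirE` case of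
its hypotheses `hL/hR`) is assembled for `b, e, f` together in `OmegaPlugBEF`.
-/

noncomputable section

open Finset Polynomial
open Literature.NumberTheory.Irrationality.Zudilin2014
open Summit.KontsevichZagierPeriods.Zeta5Search.FormalBarnes

namespace Summit.KontsevichZagierPeriods.Zeta5Search.TwoTaleOmega

namespace Pt

variable {p : Pt}

/-- Along `δ_e` the integer `d` grows by `2k`. -/
theorem dInt_addE (p : Pt) (k : ℤ) : (p.addE k).dInt = p.dInt + 2 * k := by simp [dInt, addE]; ring

/-- The first-tale truncation of `U0` may be raised to the common `d⁺(p) + 10` along `δ_e`. -/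
theorem lam0_dExp_eq_e (h0 : p.Omega) {k : ℤ} (hk : (p.addE k).Omega) (hk0 : 0 ≤ k) (hk3 : k ≤ 3) (s : ℤ) :
    lam0 (dExp (p.addE k).t1a (p.addE k).t1b) s (p.addE k).vL = lam0 (dExp p.t1a p.t1b + 10) s (p.addE k).vL := by
  refine (lam0_eq_of_le s _ (vL_natDegree_le_w hk) ?_).symm
  unfold dExp
  rw [sum_t1a_sub_sum_t1b, sum_t1a_sub_sum_t1b, dInt_addE]
  have := h0.g_le; unfold dInt; omega

/-- **The `e`-recurrence of the sign-free forms.** For `p, p+δ_e, p+2δ_e, p+3δ_e ∈ Ω`: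
`Σ_k c^e_k(p)·U1(p+kδ_e) = 0` and `Σ_k c^e_k(p)·U0(p+kδ_e) = 0`. -/
theorem rec_e (h0 : p.Omega) (h1 : (p.addE 1).Omega) (h2 : (p.addE 2).Omega) (h3 : (p.addE 3).Omega) :
    (p.coefE 0 * p.U1 + p.coefE 1 * (p.addE 1).U1 + p.coefE 2 * (p.addE 2).U1 + p.coefE 3 * (p.addE 3).U1 = 0) ∧
    (p.coefE 0 * p.U0 + p.coefE 1 * (p.addE 1).U0 + p.coefE 2 * (p.addE 2).U0 + p.coefE 3 * (p.addE 3).U0 = 0) := by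
  have hL := recL_e h0 h1 h2 h3
  have hR := recR_e h0 h1 h2 h3
  have e0 : lam0 (dExp p.t1a p.t1b) p.nodeL p.vL = lam0 (dExp p.t1a p.t1b + 10) p.nodeL p.vL :=
    (lam0_eq_of_le _ _ (vL_natDegree_le_w h0) (by omega)).symm
  have e1 := lam0_dExp_eq_e h0 h1 (by norm_num) (by norm_num) (p.addE 1).nodeL
  have e2 := lam0_dExp_eq_e h0 h2 (by norm_num) (by norm_num) (p.addE 2).nodeL
  have e3 := lam0_dExp_eq_e h0 h3 (by norm_num) (by norm_num) (p.addE 3).nodeL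
  unfold U1 U0
  rw [e0, e1, e2, e3]
  constructor
  · linear_combination hL.1 + (1 / 4 : ℚ) * hR.1
  · linear_combination hL.2 + (1 / 2 : ℚ) * hR.2

/-- **The `e`-step of the Ω-induction**: if `U1`, `U0` vanish at `p, p+δ_e, p+2δ_e` (all four points in Ω), they vanish at
`p+3δ_e`. -/
theorem step_e (h0 : p.Omega) (h1 : (p.addE 1).Omega) (h2 : (p.addE 2).Omega) (h3 : (p.addE 3).Omega)
    (u0 : p.U1 = 0 ∧ p.U0 = 0) (u1 : (p.addE 1).U1 = 0 ∧ (p.addE 1).U0 = 0)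
    (u2 : (p.addE 2).U1 = 0 ∧ (p.addE 2).U0 = 0) : (p.addE 3).U1 = 0 ∧ (p.addE 3).U0 = 0 := by
  have hc : p.coefE 3 ≠ 0 := coefE_three_ne_zero h0
  have h := rec_e h0 h1 h2 h3
  rw [u0.1, u1.1, u2.1, u0.2, u1.2, u2.2] at h
  simp only [mul_zero, zero_add] at h
  exact ⟨(mul_eq_zero.1 h.1).resolve_left hc, (mul_eq_zero.1 h.2).resolve_left hc⟩

end Pt

end Summit.KontsevichZagierPeriods.Zeta5Search.TwoTaleOmega

end
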